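import Summits.SmoothPoincare4.SmoothPoincare4.Theses.EntropyRung

/-!
# Line `density-summit-stability` — checked skeleton for crux `EntropyRung.CompactShrinkerGap`

Crux item stmt-SmoothPoincare4-10870 (route `route-SmoothPoincare4-EntropyRung`, rank 4):
for a closed smooth `M ≃ₕ S⁴`, a Riemannian `g` (Levi-Civita) and a smooth `f` with
`Ric + Hess f = g/2`, `R + |∇f|² = f` and Gaussian mass `Z := ∫ e^{-f} dV > Z₀ := 32π²√π e^{-3/2}`
(density `Θ = Z/16π² > Θ(S³×ℝ) ≈ .791`) one has `M ≅ S⁴`.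

LINE (idea card `Ideas/density-summit-stability.md`, merged by triage r1 with `decay-climb-numax`;
cut = the triage's three-way cut K_cpt / K_dom / K_rig + the Einstein endgame). Do not study the
given shrinker — study the DENSITY SUMMIT of `M`:

* `stub_summitAttained` (K_cpt): among all normalised shrinker structures on the fixed smooth `M`
  the Gaussian mass `Z` is maximised, as soon as one structure has `Z > Z₀` (Haslhofer–Müller /
  Li–Wang compactness of 4-d shrinkers under the entropy floor `log Θ > log Θ_cyl`; orbifold points
  have `Θ ≤ ½ < Θ_cyl`; non-compact limits are excluded by the sibling crux
  `NoncompactShrinkerGap`, taken as a hypothesis; Gaussian tightness of `(4π)⁻²e^{-f}dV`).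
* `stub_entropyFloorRealised` (K_dom = the rung's own engine, shared with stmt-…-10869): on
  `M ≃ₕ S⁴`, every metric with `R > 0` and `μ(g₀, τ) ≥ ν_cyl + δ` for all `τ > 0` is dominated by
  a normalised shrinker structure ON `M` of mass `≥ Z₀·e^{δ}` (Perelman monotonicity ⇒ the tangent
  flow at the first singular time has `Θ ≥ e^{ν(g₀)}`; Bamler 2020: it is a non-flat orbifold
  shrinker; above `Θ_cyl` it is compact and smooth (sibling crux + orbifold bound), and a compact
  smooth tangent flow `N` forces `M ≅ N` — transport the structure to `M`).
* composition step (proved below, no stub): maximality turns K_dom into GLOBAL ν-DOMINATION of the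
  summit `(g⋆, f⋆)` over every positive-scalar-curvature metric on `M` — the summit is in
  particular a local maximum of Perelman's `ν`, hence ν-stable (Kröncke 2015; Cao–Zhu 2012/2024).
* `stub_dominantShrinkerEinstein` (K_rig, the TRANSFER TARGET C⁺, HARDEST): a normalised shrinker
  on `M ≃ₕ S⁴` with `Z > Z₀` that is `Z`-maximal among shrinker structures on `M` and ν-dominates
  every psc metric on `M` has `Hess f ≡ 0` (is Einstein) — Cao's Conjecture 2 ("a ν-stable compact
  shrinker is Einstein, at least in dimension four") restricted to `{M ≃ₕ S⁴, Θ > Θ_cyl, globally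
  ν-maximal}`; conclusion typed ANALYTICALLY (triage r1-1/2/3 sharpening: not `M ≅ S⁴`, which
  would be SPC4-implied and content-free on the standard sphere).
* `stub_einsteinShrinkerSphere` (Einstein endgame): `Hess f ≡ 0` forces `Ric = g/2`, `R = 2`,
  `f = 2 + |∇f|² ≥ 2`, so `Z ≤ e^{-2}·Vol` and `Z > Z₀` gives `Vol > 32π²√π e^{1/2} ≈ 923 > 32π²`;
  Gursky 2000 + Hitchin (tree fact `gursky_einstein_homotopySphere_four`:
  `W ≡ 0 ∨ Vol ≤ 32π²`) leave `W ≡ 0`, constant curvature, and `M ≅ S⁴` (Hamilton PIC /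
  Kuiper; `gursky_einstein_homotopySphere_four.diffeomorph_sphere_or_volume_le`).

`CompactShrinkerGap_of : NoncompactShrinkerGap → CompactShrinkerGap` is the kernel-checked
composition (sorry-free; `sorry` only inside the four `stub_*`). The line therefore closes the
crux CONDITIONALLY on the sibling route item `NoncompactShrinkerGap` (stmt-SmoothPoincare4-10868),
exactly as the rung `SubcylindricalRecognition` already is (triage r1: "file the line explicitly
as conditional on stmt-10868"). Every stub is spelled over the crux's own fact-free vocabulary
(`riemannianMeasure (g.toContMDiffRiemannianMetric hg)`, `g.ricci`, `g.hessian`,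
`g.scalarCurvature`, `g.gradSq`; the ν-clause is the one of `SubcylindricalRecognition` with `δ`
free), so that no local definition enters a registered signature.

Disproof.lean (v3) honoured: §3 `withoutCompactHomotopy_false` — closedness (from `e`) is used by
every stub (compactness of the maximising class, `χ = 2`/`σ = 0`/`π₁ = 1` in the endgame, finite
singular time); §0/§5 — the transfer target `stub_dominantShrinkerEinstein` is NOT SPC4-implied
(its conclusion is `Hess f ≡ 0`, falsifiable by a dense non-Einstein ν-dominant shrinker on the
standard `S⁴`); §6 Jensen floor and §7 `gursky_bound_lt_threshold` are the arithmetic of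
`stub_einsteinShrinkerSphere`; §1 `hyps_round` — the round `S⁴(√6)` satisfies every stub
non-vacuously (it is its own summit: `Θ = 6/e²`). No `Negative/` lemma exists (2026-08-15).
-/

namespace Summit.SmoothPoincare4.SmoothPoincare4.Cruxes.CompactShrinkerGap.DensitySummitStability

set_option linter.dupNamespace false

open scoped Manifold ContDiff ENNReal Topology ContinuousMap
open MeasureTheory
open Summit.SmoothPoincare4.SmoothPoincare4.Theses.EntropyRung

/-- **K_cpt — the density summit of `M` is attained.** Assume the sibling crux
`NoncompactShrinkerGap` (no complete non-compact non-flat 4-d shrinker has `Θ > Θ(S³×ℝ)`).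
Let `M ≃ₕ S⁴` be closed and carry a normalised shrinker structure `(g, f)` (`f` smooth,
`Ric + Hess f = g/2`, `R + |∇f|² = f`) of Gaussian mass `∫ e^{-f} dV > Z₀ = 32π²√π e^{-3/2}`.
Then some normalised shrinker structure `(g⋆, f⋆)` on the SAME smooth manifold `M` has maximal
Gaussian mass among all normalised shrinker structures on `M`.
Intended proof: `Z ≤ 16π²` (Yokota: `Θ ≤ 1`), so the supremum is finite; a maximising sequence has
`Θ ≥ Θ(g) > Θ_cyl > ½`; 4-d shrinker compactness under an entropy lower bound
(Haslhofer–Müller 2011/2015, Li–Wang 2020) gives a pointed orbifold-shrinker limit; Gaussian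
tightness of `(4π)⁻² e^{-f} dV` (Haslhofer–Müller Rem. p. 7, Cao–Zhou potential bounds) makes `Θ`
continuous in the limit; an orbifold point forces `Θ ≤ ½`, a non-compact limit is non-flat with
`Θ > Θ_cyl` (excluded by the hypothesis) — so the limit is a compact smooth shrinker `N`, the
convergence is smooth and `N ≅ M`; transport the structure to `M`. [size L/XL]
[cite: HaslhoferMuller2011, Thm 1.1–1.2] -/
theorem stub_summitAttained : NoncompactShrinkerGap →
    ∀ (M : Type) [TopologicalSpace M] [T2Space M] [SecondCountableTopology M]
      [ChartedSpace (EuclideanSpace ℝ (Fin 4)) M] [IsManifold (𝓡 4) ∞ M] [CompactSpace M] [T3Space M]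
      [MeasurableSpace M] [BorelSpace M], M ≃ₕ Metric.sphere (0 : EuclideanSpace ℝ (Fin 5)) 1 →
    ∀ (g : Literature.Geometry.Lorentzian.PseudoRiemannianMetric (𝓡 4) ∞ (EuclideanSpace ℝ (Fin 4)) (TangentSpace (𝓡 4) : M → Type _))
      [g.HasLeviCivita] (f : M → ℝ) (hg : g.IsRiemannian),
      ContMDiff (𝓡 4) 𝓘(ℝ, ℝ) ∞ f →
      (∀ (x : M) (X Y : TangentSpace (𝓡 4) x), g.ricci x X Y + g.hessian f x X Y = (1 / 2 : ℝ) * g.val x X Y) →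
      (∀ x : M, g.scalarCurvature x + g.gradSq f x = f x) →
      ENNReal.ofReal (32 * Real.pi ^ 2 * Real.sqrt Real.pi * Real.exp (-(3 : ℝ) / 2)) <
        ∫⁻ x, ENNReal.ofReal (Real.exp (-f x)) ∂(Literature.Geometry.Lorentzian.riemannianMeasure (g.toContMDiffRiemannianMetric hg)) →
      ∃ (g' : Literature.Geometry.Lorentzian.PseudoRiemannianMetric (𝓡 4) ∞ (EuclideanSpace ℝ (Fin 4)) (TangentSpace (𝓡 4) : M → Type _))
        (_ : g'.HasLeviCivita) (f' : M → ℝ) (hg' : g'.IsRiemannian),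
        (ContMDiff (𝓡 4) 𝓘(ℝ, ℝ) ∞ f' ∧
          (∀ (x : M) (X Y : TangentSpace (𝓡 4) x), g'.ricci x X Y + g'.hessian f' x X Y = (1 / 2 : ℝ) * g'.val x X Y) ∧
          (∀ x : M, g'.scalarCurvature x + g'.gradSq f' x = f' x)) ∧
        ∀ (g'' : Literature.Geometry.Lorentzian.PseudoRiemannianMetric (𝓡 4) ∞ (EuclideanSpace ℝ (Fin 4)) (TangentSpace (𝓡 4) : M → Type _))
          [g''.HasLeviCivita] (f'' : M → ℝ) (hg'' : g''.IsRiemannian),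
          ContMDiff (𝓡 4) 𝓘(ℝ, ℝ) ∞ f'' →
          (∀ (x : M) (X Y : TangentSpace (𝓡 4) x), g''.ricci x X Y + g''.hessian f'' x X Y = (1 / 2 : ℝ) * g''.val x X Y) →
          (∀ x : M, g''.scalarCurvature x + g''.gradSq f'' x = f'' x) →
          ∫⁻ x, ENNReal.ofReal (Real.exp (-f'' x)) ∂(Literature.Geometry.Lorentzian.riemannianMeasure (g''.toContMDiffRiemannianMetric hg'')) ≤
            ∫⁻ x, ENNReal.ofReal (Real.exp (-f' x)) ∂(Literature.Geometry.Lorentzian.riemannianMeasure (g'.toContMDiffRiemannianMetric hg')) := by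
  sorry

/-- **K_dom — every super-cylindrical entropy floor on `M` is realised by a shrinker ON `M`**
(the engine of the rung `SubcylindricalRecognition`, stmt-SmoothPoincare4-10869, minus the present
crux). Assume `NoncompactShrinkerGap`. Let `M ≃ₕ S⁴` be closed, `g₀` Riemannian (Levi-Civita) with
`R > 0` everywhere, and `δ > 0` with `μ(g₀, τ) ≥ ν_cyl + δ` for every `τ > 0` (typed verbatim as in
`SubcylindricalRecognition`: for all smooth `φ` with `∫ (4πτ)⁻² e^{-φ} dV₀ = 1`,
`log 2 + ½ log π − 3/2 + δ ≤ 𝒲(g₀, φ, τ)`). Then `M` carries a normalised shrinker structure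
`(g₁, f₁)` of Gaussian mass `∫ e^{-f₁} dV₁ ≥ Z₀·e^{δ}` (`Z₀ = 32π²√π e^{-3/2} = 16π²·Θ(S³×ℝ)`).
Intended proof: `R > 0` ⇒ the Ricci flow of `g₀` is singular at some `T ≤ 2/R_min`; Perelman's
monotonicity gives `μ(g(t), T − t) ≥ μ(g₀, T) ≥ ν_cyl + δ`; by Bamler 2020 (§2.6, §2.10) a tangent
flow at a singular point `(x, T)` is a non-flat orbifold gradient shrinker `N` of density
`Θ(N) = e^{𝒩_{x,T}(0)} ≥ e^{ν_cyl + δ} > Θ_cyl`; orbifold points force `Θ ≤ ½`, a non-compact `N`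
is excluded by `NoncompactShrinkerGap`, so `N` is compact and smooth, the rescaled flow converges
smoothly and `M ≅ N` (Bamler: compact smooth tangent flow ⇒ global convergence); pull `(g_N, f_N)`
back to `M` (normalised potential; `Θ(N) = (4π)⁻² ∫ e^{-f_N}`, Carrillo–Ni). [size XL — Bamler's
package is not in the library; shared debt with stmt-SmoothPoincare4-10869]
[cite: Bamler2020Structure, §2.6 and §2.10] [cite: Perelman2002Entropy, §3.1 (3.4)] -/
theorem stub_entropyFloorRealised : NoncompactShrinkerGap →
    ∀ (M : Type) [TopologicalSpace M] [T2Space M] [SecondCountableTopology M]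
      [ChartedSpace (EuclideanSpace ℝ (Fin 4)) M] [IsManifold (𝓡 4) ∞ M] [CompactSpace M] [T3Space M]
      [MeasurableSpace M] [BorelSpace M], M ≃ₕ Metric.sphere (0 : EuclideanSpace ℝ (Fin 5)) 1 →
    ∀ (g₀ : Literature.Geometry.Lorentzian.PseudoRiemannianMetric (𝓡 4) ∞ (EuclideanSpace ℝ (Fin 4)) (TangentSpace (𝓡 4) : M → Type _))
      [g₀.HasLeviCivita] (hg₀ : g₀.IsRiemannian),
      (∀ x : M, 0 < g₀.scalarCurvature x) →
      ∀ δ : ℝ, 0 < δ →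
      (∀ τ : ℝ, 0 < τ → ∀ φ : M → ℝ, ContMDiff (𝓡 4) 𝓘(ℝ, ℝ) ∞ φ →
        ∫ x, (4 * Real.pi * τ) ^ (-(4 : ℝ) / 2) * Real.exp (-φ x) ∂(Literature.Geometry.Lorentzian.riemannianMeasure (g₀.toContMDiffRiemannianMetric hg₀)) = 1 →
        Real.log 2 + Real.log Real.pi / 2 - 3 / 2 + δ ≤
          ∫ x, (τ * (g₀.scalarCurvature x + g₀.gradSq φ x) + φ x - 4) * ((4 * Real.pi * τ) ^ (-(4 : ℝ) / 2) * Real.exp (-φ x)) ∂(Literature.Geometry.Lorentzian.riemannianMeasure (g₀.toContMDiffRiemannianMetric hg₀))) →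
      ∃ (g₁ : Literature.Geometry.Lorentzian.PseudoRiemannianMetric (𝓡 4) ∞ (EuclideanSpace ℝ (Fin 4)) (TangentSpace (𝓡 4) : M → Type _))
        (_ : g₁.HasLeviCivita) (f₁ : M → ℝ) (hg₁ : g₁.IsRiemannian),
        (ContMDiff (𝓡 4) 𝓘(ℝ, ℝ) ∞ f₁ ∧
          (∀ (x : M) (X Y : TangentSpace (𝓡 4) x), g₁.ricci x X Y + g₁.hessian f₁ x X Y = (1 / 2 : ℝ) * g₁.val x X Y) ∧
          (∀ x : M, g₁.scalarCurvature x + g₁.gradSq f₁ x = f₁ x)) ∧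
        ENNReal.ofReal (32 * Real.pi ^ 2 * Real.sqrt Real.pi * Real.exp (-(3 : ℝ) / 2) * Real.exp δ) ≤
          ∫⁻ x, ENNReal.ofReal (Real.exp (-f₁ x)) ∂(Literature.Geometry.Lorentzian.riemannianMeasure (g₁.toContMDiffRiemannianMetric hg₁)) := by
  sorry

/-- **K_rig — TRANSFER TARGET C⁺ (hardest stub): a dense, `Z`-maximal, ν-dominant shrinker on a
homotopy 4-sphere is Einstein.** Let `M ≃ₕ S⁴` be closed with a normalised shrinker structure
`(g, f)` of Gaussian mass `Z > Z₀` which (a) has maximal mass among all normalised shrinker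
structures on `M` and (b) ν-dominates every positive-scalar-curvature metric `g₀` on `M`: whenever
`μ(g₀, τ) ≥ ν_cyl + δ` for all `τ > 0` (`δ > 0`), then `Z₀·e^{δ} ≤ Z`, i.e. `ν(g₀) ≤ log Θ(g, f)`.
Then `Hess f ≡ 0` (equivalently `Ric = g/2`: the shrinker is Einstein).
Why plausible / intended attack: `g` has `R > 0` and `ν(g) = μ(g, 1) = log Θ` (Carrillo–Ni), and
`R > 0`, `ν > ν_cyl` are open conditions, so (b) makes `g` a LOCAL MAXIMUM of Perelman's ν on
`Met(M)`, hence dynamically and linearly stable (Kröncke 2015 Thm 1.2–1.3; second variation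
`N̂ ≤ 0`, Cao–Hamilton–Ilmanen 2004 Thm 1.1; ⇔ `ℒ_f ≤ 0` on `Ker(div_f)₀`, Cao–Zhu 2024 Thm 1.2)
and moreover free of neutral non-Einstein directions (genuine local maximality, cf. Knopf–Šešum
on `ℂPⁿ`). The statement is then Cao's Conjecture 2 (Cao 2006; Cao–Zhu 2024 §3, Conj. 2: "a
ν-stable compact shrinking soliton is Einstein, at least in dimension four") in the class
`{M ≃ₕ S⁴ (so b₂ = 0: no Kähler / harmonic-2-form destabilisers), Θ > Θ_cyl, globally ν-maximal}`,
where every known non-round compact 4-d shrinker is excluded twice (all have `Θ ≤ .609` and all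
are ν-unstable: Hall–Murphy, Hall–Haslhofer–Siepmann, Biquard–Ozuch). First computation to cash
(card): with `E̊ = Ric − (R/4)g`, `4∫|E̊|²e^{-f} = ∫R(2−R)e^{-f}` (from `Δ_f R = R − 2|Ric|²`) and
`⟨ℒ_f E̊, E̊⟩_f = ¼∫(2−R)|E̊|²e^{-f}` (from `Δ_f Rc + 2Rm(Rc,·) = Rc`), tested against `ℒ_f ≤ 0`
after projecting `E̊` to `Ker(div_f)` (`div_f E̊ = −½E̊(∇f) + (R/8)∇f`). NOT SPC4-implied: on the
standard `S⁴` it asserts that a shrinker with `Θ ≥ Θ(S⁴_round) = 6/e²` dominating all psc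
metrics is Einstein (hence round). [size: open problem (special case of Cao's Conj. 2)]
[cite: CaoZhu2023, Thm 1.2 and Conj. 2] [cite: Kroencke2014, Thm 1.2–1.3] [cite: CaoHamiltonIlmanen2004, Thm 1.1] -/
theorem stub_dominantShrinkerEinstein :
    ∀ (M : Type) [TopologicalSpace M] [T2Space M] [SecondCountableTopology M]
      [ChartedSpace (EuclideanSpace ℝ (Fin 4)) M] [IsManifold (𝓡 4) ∞ M] [CompactSpace M] [T3Space M]
      [MeasurableSpace M] [BorelSpace M], M ≃ₕ Metric.sphere (0 : EuclideanSpace ℝ (Fin 5)) 1 →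
    ∀ (g : Literature.Geometry.Lorentzian.PseudoRiemannianMetric (𝓡 4) ∞ (EuclideanSpace ℝ (Fin 4)) (TangentSpace (𝓡 4) : M → Type _))
      [g.HasLeviCivita] (f : M → ℝ) (hg : g.IsRiemannian),
      ContMDiff (𝓡 4) 𝓘(ℝ, ℝ) ∞ f →
      (∀ (x : M) (X Y : TangentSpace (𝓡 4) x), g.ricci x X Y + g.hessian f x X Y = (1 / 2 : ℝ) * g.val x X Y) →
      (∀ x : M, g.scalarCurvature x + g.gradSq f x = f x) →
      ENNReal.ofReal (32 * Real.pi ^ 2 * Real.sqrt Real.pi * Real.exp (-(3 : ℝ) / 2)) <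
        ∫⁻ x, ENNReal.ofReal (Real.exp (-f x)) ∂(Literature.Geometry.Lorentzian.riemannianMeasure (g.toContMDiffRiemannianMetric hg)) →
      (∀ (g'' : Literature.Geometry.Lorentzian.PseudoRiemannianMetric (𝓡 4) ∞ (EuclideanSpace ℝ (Fin 4)) (TangentSpace (𝓡 4) : M → Type _))
          [g''.HasLeviCivita] (f'' : M → ℝ) (hg'' : g''.IsRiemannian),
          ContMDiff (𝓡 4) 𝓘(ℝ, ℝ) ∞ f'' →
          (∀ (x : M) (X Y : TangentSpace (𝓡 4) x), g''.ricci x X Y + g''.hessian f'' x X Y = (1 / 2 : ℝ) * g''.val x X Y) →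
          (∀ x : M, g''.scalarCurvature x + g''.gradSq f'' x = f'' x) →
          ∫⁻ x, ENNReal.ofReal (Real.exp (-f'' x)) ∂(Literature.Geometry.Lorentzian.riemannianMeasure (g''.toContMDiffRiemannianMetric hg'')) ≤
            ∫⁻ x, ENNReal.ofReal (Real.exp (-f x)) ∂(Literature.Geometry.Lorentzian.riemannianMeasure (g.toContMDiffRiemannianMetric hg))) →
      (∀ (g₀ : Literature.Geometry.Lorentzian.PseudoRiemannianMetric (𝓡 4) ∞ (EuclideanSpace ℝ (Fin 4)) (TangentSpace (𝓡 4) : M → Type _))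
          [g₀.HasLeviCivita] (hg₀ : g₀.IsRiemannian),
          (∀ x : M, 0 < g₀.scalarCurvature x) →
          ∀ δ : ℝ, 0 < δ →
          (∀ τ : ℝ, 0 < τ → ∀ φ : M → ℝ, ContMDiff (𝓡 4) 𝓘(ℝ, ℝ) ∞ φ →
            ∫ x, (4 * Real.pi * τ) ^ (-(4 : ℝ) / 2) * Real.exp (-φ x) ∂(Literature.Geometry.Lorentzian.riemannianMeasure (g₀.toContMDiffRiemannianMetric hg₀)) = 1 →
            Real.log 2 + Real.log Real.pi / 2 - 3 / 2 + δ ≤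
              ∫ x, (τ * (g₀.scalarCurvature x + g₀.gradSq φ x) + φ x - 4) * ((4 * Real.pi * τ) ^ (-(4 : ℝ) / 2) * Real.exp (-φ x)) ∂(Literature.Geometry.Lorentzian.riemannianMeasure (g₀.toContMDiffRiemannianMetric hg₀))) →
          ENNReal.ofReal (32 * Real.pi ^ 2 * Real.sqrt Real.pi * Real.exp (-(3 : ℝ) / 2) * Real.exp δ) ≤
            ∫⁻ x, ENNReal.ofReal (Real.exp (-f x)) ∂(Literature.Geometry.Lorentzian.riemannianMeasure (g.toContMDiffRiemannianMetric hg))) →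
      ∀ x : M, g.hessian f x = 0 := by
  sorry

/-- **Einstein endgame — a dense Einstein shrinker on a homotopy 4-sphere is the round `S⁴`.**
Let `M ≃ₕ S⁴` be closed with a normalised shrinker structure `(g, f)` of Gaussian mass `Z > Z₀`
and `Hess f ≡ 0`. Then `M ≅ S⁴`.
Intended proof: `Hess f = 0` gives `Ric = g/2`, so `R = 2` (trace, Riemannian, dim 4) and
`f = R + |∇f|² ≥ 2` pointwise, whence `Z = ∫ e^{-f} dV ≤ e^{-2}·Vol(M)`; with `Z > Z₀` this is
`Vol > 32π²√π e^{1/2} ≈ 923` (Disproof §6 `volume_floor_of_density`), in particular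
`Vol > 32π²` (`thirtyTwo_pi_sq_exp_neg_two_lt`); the tree's
`gursky_einstein_homotopySphere_four.diffeomorph_sphere_or_volume_le` (Gursky 2000 Thm 1 +
Hitchin: `M ≅ S⁴` or `Vol ≤ 8π²/λ² = 32π²` at `λ = ½`, via constant curvature and
`hamilton_pic_sphere_four` / Kuiper) leaves `M ≅ S⁴`. [size M, modulo the two named facts
`gursky_einstein_homotopySphere_four` and `hamilton_pic_sphere_four` (or `kuiper_developingMap`),
both unproved in the tree — the route's declared cite debt for this crux]
[cite: Gursky2000, Thm 1] [cite: Hitchin1974, Thm 1] -/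
theorem stub_einsteinShrinkerSphere :
    ∀ (M : Type) [TopologicalSpace M] [T2Space M] [SecondCountableTopology M]
      [ChartedSpace (EuclideanSpace ℝ (Fin 4)) M] [IsManifold (𝓡 4) ∞ M] [CompactSpace M] [T3Space M]
      [MeasurableSpace M] [BorelSpace M], M ≃ₕ Metric.sphere (0 : EuclideanSpace ℝ (Fin 5)) 1 →
    ∀ (g : Literature.Geometry.Lorentzian.PseudoRiemannianMetric (𝓡 4) ∞ (EuclideanSpace ℝ (Fin 4)) (TangentSpace (𝓡 4) : M → Type _))
      [g.HasLeviCivita] (f : M → ℝ) (hg : g.IsRiemannian),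
      ContMDiff (𝓡 4) 𝓘(ℝ, ℝ) ∞ f →
      (∀ (x : M) (X Y : TangentSpace (𝓡 4) x), g.ricci x X Y + g.hessian f x X Y = (1 / 2 : ℝ) * g.val x X Y) →
      (∀ x : M, g.scalarCurvature x + g.gradSq f x = f x) →
      (∀ x : M, g.hessian f x = 0) →
      ENNReal.ofReal (32 * Real.pi ^ 2 * Real.sqrt Real.pi * Real.exp (-(3 : ℝ) / 2)) <
        ∫⁻ x, ENNReal.ofReal (Real.exp (-f x)) ∂(Literature.Geometry.Lorentzian.riemannianMeasure (g.toContMDiffRiemannianMetric hg)) →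
      Nonempty (M ≃ₘ⟮𝓡 4, 𝓡 4⟯ (Metric.sphere (0 : EuclideanSpace ℝ (Fin 5)) 1)) := by
  sorry

/-- **Composition (kernel-checked, no `sorry` of its own): the four stubs and the sibling crux
`NoncompactShrinkerGap` imply `CompactShrinkerGap`.** Take the density summit `(g⋆, f⋆)` of `M`
(`stub_summitAttained`); it is denser than the given structure, so `Z⋆ > Z₀`; every psc metric's
super-cylindrical entropy floor is realised by some shrinker on `M` (`stub_entropyFloorRealised`)
whose mass is at most `Z⋆` by maximality — so the summit ν-dominates all psc metrics; hence it is
Einstein (`stub_dominantShrinkerEinstein`) and `M ≅ S⁴` (`stub_einsteinShrinkerSphere`). -/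
theorem CompactShrinkerGap_of (hnc : NoncompactShrinkerGap) : CompactShrinkerGap := by
  intro M _ _ _ _ _ _ _ _ _ e g _ f hg hf hsol hnorm hZ
  obtain ⟨g₁, i₁, f₁, hg₁, ⟨hf₁, hsol₁, hnorm₁⟩, hmax⟩ :=
    stub_summitAttained hnc M e g f hg hf hsol hnorm hZ
  have hZ₁ : ENNReal.ofReal (32 * Real.pi ^ 2 * Real.sqrt Real.pi * Real.exp (-(3 : ℝ) / 2)) <
      ∫⁻ x, ENNReal.ofReal (Real.exp (-f₁ x))
        ∂(Literature.Geometry.Lorentzian.riemannianMeasure (g₁.toContMDiffRiemannianMetric hg₁)) :=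
    lt_of_lt_of_le hZ (hmax g f hg hf hsol hnorm)
  have hE : ∀ x : M, g₁.hessian f₁ x = 0 :=
    stub_dominantShrinkerEinstein M e g₁ f₁ hg₁ hf₁ hsol₁ hnorm₁ hZ₁ hmax
      (fun g₀ _ hg₀ hR₀ δ hδ hν => by
        obtain ⟨g₂, i₂, f₂, hg₂, ⟨hf₂, hsol₂, hnorm₂⟩, hZ₂⟩ :=
          stub_entropyFloorRealised hnc M e g₀ hg₀ hR₀ δ hδ hν
        exact hZ₂.trans (hmax g₂ f₂ hg₂ hf₂ hsol₂ hnorm₂))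
  exact stub_einsteinShrinkerSphere M e g₁ f₁ hg₁ hf₁ hsol₁ hnorm₁ hE hZ₁

end Summit.SmoothPoincare4.SmoothPoincare4.Cruxes.CompactShrinkerGap.DensitySummitStability
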